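import Summits.Ventures.HodgeRepro2.T5SU11SphericalDecayFluxIdentity
import Summits.Ventures.HodgeRepro2.T5SU11KernelEnds
import Summits.Ventures.HodgeRepro2.T5SU11SphericalMonotone
import Summits.Ventures.HodgeRepro2.T5SU11JacobiPhaseLawRateOutside

/-!
# Monotonicity of the kernel's rows and domination by the diagonal

With `χ_λ` strictly decreasing (row 636) and `φ_λ` strictly monotone in `t` (row 2xx: decreasing for `λ < 2`, increasing for `λ > 2`),
the explicit formulas `K_λ(t, s) = −χ_λ(s) φ_λ(a_t)` (`t ≤ s`), `−φ_λ(a_s) χ_λ(t)` (`t ≥ s`) give: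

* `kernel_strictMonoOn_Ici` — **`t ↦ K_λ(t, s)` is strictly increasing on `[s, ∞)`** (it rises to `0`) for every `λ > 1`;
* `kernel_strictMonoOn_of_lt_two` — for `1 < λ < 2` it is strictly increasing on all of `(0, ∞)`: **the row's modulus is largest
  at the origin**;
* `kernel_strictAntiOn_Ioc_of_two_lt` — for `λ > 2` it is strictly decreasing on `(0, s]`: **the row's modulus peaks on the diagonal**;
* `abs_kernel_le_diagonal_min` — **`|K_λ(t, s)| ≤ φ_λ(a_r) χ_λ(r)`, `r = min(t, s)`** — the kernel is dominated by its diagonal value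
  at the smaller variable, for every `λ > 1` (only `χ_λ ↓` is used);
* `abs_kernel_le_diagonal_max` — for `λ ≥ 2` also `|K_λ(t, s)| ≤ φ_λ(a_R) χ_λ(R)`, `R = max(t, s)`.

Nothing is claimed about (N).

Blind lane: Mathlib + the HodgeRepro2 prefix only; no sorry; axioms ⊆ {propext, Classical.choice,
Quot.sound}.
-/

namespace Summit.Ventures.HodgeRepro2.T5SU11KernelRowMonotone

open Filter Topology MeasureTheory
open Set (Ioi Ioc Ici)
open T5SU11Cartan T5SU11SphericalFunction T5SU11SphericalBounds T5SU11SphericalDecay T5SU11SphericalMonotone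
  T5SU11RadialGreenKernel T5SU11KernelEnds T5SU11SphericalDecayFluxIdentity

section measure

variable [MeasurableSpace Circle] [BorelSpace Circle]

variable {lam : ℝ} (hlam : 1 < lam)

include hlam in
/-- **`t ↦ K_λ(t, s)` is strictly increasing on `[s, ∞)`** for `s > 0`. -/
theorem kernel_strictMonoOn_Ici {s : ℝ} (hs : 0 < s) : StrictMonoOn (fun t => sphGreenKernel lam t s) (Ici s) := by
  intro t₁ ht₁ t₂ ht₂ h12
  simp only
  rw [kernel_eq_of_ge lam ht₁, kernel_eq_of_ge lam ht₂]
  have hφ : 0 < sph lam (hyp s) := sph_hyp_pos lam s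
  have hχ : sphDecay lam t₂ < sphDecay lam t₁ :=
    sphDecay_strictAntiOn hlam (lt_of_lt_of_le hs ht₁) (lt_of_lt_of_le hs ht₂) h12
  nlinarith

include hlam in
/-- For `1 < λ < 2`, **`t ↦ K_λ(t, s)` is strictly increasing on `(0, ∞)`**. -/
theorem kernel_strictMonoOn_of_lt_two (h2 : lam < 2) {s : ℝ} (hs : 0 < s) :
    StrictMonoOn (fun t => sphGreenKernel lam t s) (Ioi 0) := by
  have hanti := strictAntiOn_sph_hyp (by linarith : 0 < lam) h2
  have hχ : 0 < sphDecay lam s := sphDecay_pos hlam hs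
  intro t₁ ht₁ t₂ ht₂ h12
  have ht₁' : (0 : ℝ) < t₁ := ht₁
  have ht₂' : (0 : ℝ) < t₂ := ht₂
  simp only
  rcases le_or_gt t₂ s with h2s | h2s
  · -- both at or before the diagonal
    rw [kernel_eq_of_le lam (le_of_lt (lt_of_lt_of_le h12 h2s)), kernel_eq_of_le lam h2s]
    have := hanti ht₁'.le ht₂'.le h12
    nlinarith
  · rcases le_or_gt s t₁ with h1s | h1s
    · exact kernel_strictMonoOn_Ici hlam hs (Set.mem_Ici.mpr h1s) (Set.mem_Ici.mpr h2s.le) h12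
    · -- `t₁ < s < t₂`: through the diagonal
      have hA : sphGreenKernel lam t₁ s < sphGreenKernel lam s s := by
        rw [kernel_eq_of_le lam h1s.le, kernel_eq_of_le lam le_rfl]
        have := hanti ht₁'.le hs.le h1s
        nlinarith
      have hB : sphGreenKernel lam s s < sphGreenKernel lam t₂ s :=
        kernel_strictMonoOn_Ici hlam hs Set.self_mem_Ici (Set.mem_Ici.mpr h2s.le) h2s
      exact lt_trans hA hB

include hlam in
/-- For `λ > 2`, **`t ↦ K_λ(t, s)` is strictly decreasing on `(0, s]`** (the row's modulus peaks on the diagonal). -/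
theorem kernel_strictAntiOn_Ioc_of_two_lt (h2 : 2 < lam) {s : ℝ} (hs : 0 < s) :
    StrictAntiOn (fun t => sphGreenKernel lam t s) (Ioc 0 s) := by
  have hmono := strictMonoOn_sph_hyp (Or.inr h2 : lam < 0 ∨ 2 < lam)
  have hχ : 0 < sphDecay lam s := sphDecay_pos hlam hs
  intro t₁ ht₁ t₂ ht₂ h12
  simp only
  rw [kernel_eq_of_le lam ht₁.2, kernel_eq_of_le lam ht₂.2]
  have := hmono ht₁.1.le ht₂.1.le h12
  nlinarith

include hlam in
/-- **The kernel is dominated by its diagonal at the smaller variable**: `|K_λ(t, s)| ≤ φ_λ(a_r) χ_λ(r)`, `r = min(t, s)`. -/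
theorem abs_kernel_le_diagonal_min {t s : ℝ} (ht : 0 < t) (hs : 0 < s) :
    |sphGreenKernel lam t s| ≤ sph lam (hyp (min t s)) * sphDecay lam (min t s) := by
  rcases le_total t s with hts | hst
  · rw [min_eq_left hts, kernel_eq_of_le lam hts, abs_neg, abs_of_pos (mul_pos (sphDecay_pos hlam hs) (sph_hyp_pos lam t))]
    have hχ : sphDecay lam s ≤ sphDecay lam t := (sphDecay_strictAntiOn hlam).antitoneOn ht hs hts
    have hφ : 0 < sph lam (hyp t) := sph_hyp_pos lam t
    nlinarith
  · rw [min_eq_right hst, kernel_eq_of_ge lam hst, abs_neg, abs_of_pos (mul_pos (sph_hyp_pos lam s) (sphDecay_pos hlam ht))]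
    have hχ : sphDecay lam t ≤ sphDecay lam s := (sphDecay_strictAntiOn hlam).antitoneOn hs ht hst
    have hφ : 0 < sph lam (hyp s) := sph_hyp_pos lam s
    nlinarith

include hlam in
/-- For `λ ≥ 2` the kernel is also dominated by its diagonal at the larger variable: `|K_λ(t, s)| ≤ φ_λ(a_R) χ_λ(R)`,
`R = max(t, s)`. -/
theorem abs_kernel_le_diagonal_max (h2 : 2 ≤ lam) {t s : ℝ} (ht : 0 < t) (hs : 0 < s) :
    |sphGreenKernel lam t s| ≤ sph lam (hyp (max t s)) * sphDecay lam (max t s) := by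
  rcases le_total t s with hts | hst
  · rw [max_eq_right hts, kernel_eq_of_le lam hts, abs_neg, abs_of_pos (mul_pos (sphDecay_pos hlam hs) (sph_hyp_pos lam t))]
    have hφ : sph lam (hyp t) ≤ sph lam (hyp s) :=
      T5SU11JacobiPhaseLawRateOutside.sph_hyp_le_sph_hyp_of_two_le h2 ht.le hts
    have hχ : 0 < sphDecay lam s := sphDecay_pos hlam hs
    nlinarith
  · rw [max_eq_left hst, kernel_eq_of_ge lam hst, abs_neg, abs_of_pos (mul_pos (sph_hyp_pos lam s) (sphDecay_pos hlam ht))]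
    have hφ : sph lam (hyp s) ≤ sph lam (hyp t) :=
      T5SU11JacobiPhaseLawRateOutside.sph_hyp_le_sph_hyp_of_two_le h2 hs.le hst
    have hχ : 0 < sphDecay lam t := sphDecay_pos hlam ht
    nlinarith

end measure

end Summit.Ventures.HodgeRepro2.T5SU11KernelRowMonotone
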